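import Summits.BirchSwinnertonDyer.BirchSwinnertonDyer.Theorems.ByReductionTypeAtTwoMultTowerSplitOrderTwoAdicDepth
import Summits.BirchSwinnertonDyer.BirchSwinnertonDyer.Theorems.ByReductionTypeAtTwoMultTowerNS2TwistedTateAlgebra
import HarnessLib

/-!
# Route `ByReductionTypeAtTwo`, crux `MultUpperHalfAtTwo` (item stmt-BirchSwinnertonDyer-19922), TOWER road, the
# SPLIT rows: KERNEL BRICK S2 — the DEPTH non-norm lemmas: `q^{2^j a} ∉ N(F_{j+w+1}ˣ)` for a Tate parameter
# `q = 2^k u` of depth `w` (`‖u² − 1‖ = 2^{−(w+3)}`, i.e. `ord₂ log₂ q = w + 2`), absolute and relative (orbit-product) form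

HONEST FRAMING (cell `bsd-2adic`, run/shared/lean/pub/bsd-2adic/, seat `bsd-2adic-mult` GEN 13, HUMAN RULINGS
D-0036 / D-0054 / D-0074): TOOL theorems only (no definition, no named fact, no `sorry`); closes nothing by itself;
nothing booked; BSD is not proved by any of this. Second brick of the KERNEL proof of the projection of the PRINT named
fact `Greenberg1999.sec3_natCard_localTowerKerPrimary_splitMultiplicative_rat` consumed by the split TOWER doors
(`MultTowerCert.atTwo_le_pow_of_split`). DEPTH-`w` generalisations of tower-1's BRICK 14 tail
(`MultTowerNS2.norm_ne_pow_of_tateUnit`, `w = 0`) and BRICK 15 tail (`MultTowerNS2.prod_smul_ne_pow_of_tateUnit`), with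
the SAME proofs: the norm group of the `m`-th local layer `F_m` of the cyclotomic `ℤ₂`-tower at `v ∋ 2` is
`⟨2⟩ · ±(1 + 2^{m+2}ℤ₂)` (tower-1's `mem_range_norm_fixedField_layer_iff`, from the PROVED local class field axiom), and the
unit part `u^{2^j a}` of `q^{2^j a}` is `≢ ±1 (mod 2^{j+w+3})` (BRICK S1 `toZModPow_pow_ne_one_and_ne_neg_one_of_depth`).
Setting: `κ` THE cyclotomic `ℤ₂`-extension, `v ∋ 2`, `H_m = localSubgroup (κ.layerSubgroup m) ℚ_v`, `F_m = K̄_v^{H_m}`,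
`e : ℚ_v ≃+* ℚ₂` any ring isomorphism, `q ∈ ℚ_v` with `e q = 2^k u`, `u ∈ ℤ₂ˣ`.

* `prod_smul_two_pow_succ` / `prod_smul_two_pow_add` — orbit products one / several layers up: `N_{R+1}(x) = N_R(x)²`,
  `N_{R+i}(x) = N_R(x)^{2^i}` when `g^{2^R} x = x` (any field);
* `norm_ne_pow_of_depth` — **`N_{F_m/ℚ_v}(f) ≠ q^{2^j a}`** for `m = j + w + 1`, `a` odd;
* `prod_smul_ne_pow_of_depth` — **`∏_{i<2^R} g^i f ≠ q^{2^j a}`** for `f ∈ K̄_v^{H_{n+R}}`, `R = j + w + 1`, `g` a topological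
  generator of `H_n` mod `H_∞` (`κ(res g) = 2^n u_g`) — the relative non-norm lemma over `F_n` in the orbit-product
  form the split count consumes (representatives `g₀^i g^j` of `Γ/H_{n+R}` reduce it to the absolute one at level `n + R`).

References: R. Greenberg, LNM 1716 (1999), §3 pp. 92–93; J. Neukirch, *ANT* V (1.1); L. Washington, GTM 83, §13.1;
cell memo HOME/mult/NOTE-SP1ONE.md §5.
-/

set_option autoImplicit false
-- the Theorems namespace of this sub repeats the summit name by design (D-0017 nested layout: Summit.<S>.<Sub>)
set_option linter.dupNamespace false

noncomputable section

open scoped Classical IntermediateField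

namespace Summit.BirchSwinnertonDyer.BirchSwinnertonDyer.Theorems.MultTowerSplitOrder

open NumberField IsDedekindDomain Field PadicInt Literature.NumberTheory.EllipticCurves
  Literature.NumberTheory.GaloisRepresentations
  Summit.BirchSwinnertonDyer.BirchSwinnertonDyer.Theorems.MultTowerNS2

/-! ### Orbit products several layers up -/

section OrbitProducts

variable {K : Type*} [Field K]

/-- **`N_{R+1}(x) = N_R(x)²` when `g^{2^R} x = x`**: `∏_{i<2^{R+1}} g^i x = N_R(x) · g^{2^R} N_R(x)` and `g^{2^R}` fixes
`N_R(x)`. [folklore] -/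
theorem prod_smul_two_pow_succ (g : absoluteGaloisGroup K) (R : ℕ) {x : AlgebraicClosure K}
    (hx : (g ^ 2 ^ R) • x = x) :
    (∏ i ∈ Finset.range (2 ^ (R + 1)), (g ^ i) • x) = (∏ i ∈ Finset.range (2 ^ R), (g ^ i) • x) ^ 2 := by
  rw [pow_succ', prod_smul_range_two_mul, pow_smul_prod_smul_eq g (2 ^ R) hx, sq]

/-- **`N_{R+i}(x) = N_R(x)^{2^i}` when `g^{2^R} x = x`.** [folklore] -/
theorem prod_smul_two_pow_add (g : absoluteGaloisGroup K) (R : ℕ) {x : AlgebraicClosure K}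
    (hx : (g ^ 2 ^ R) • x = x) (i : ℕ) :
    (∏ i ∈ Finset.range (2 ^ (R + i)), (g ^ i) • x) = (∏ i ∈ Finset.range (2 ^ R), (g ^ i) • x) ^ 2 ^ i := by
  induction i with
  | zero => simp
  | succ i ih =>
    have hxi : (g ^ 2 ^ (R + i)) • x = x := by
      rw [pow_add, pow_mul]
      -- `(g^{2^R})^{2^i} x = x`
      have h : ∀ n : ℕ, ((g ^ 2 ^ R) ^ n) • x = x := fun n ↦ by
        induction n with
        | zero => rw [pow_zero, one_smul]
        | succ n ihn => rw [pow_succ, mul_smul, hx, ihn]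
      exact h _
    rw [show R + (i + 1) = (R + i) + 1 by ring, prod_smul_two_pow_succ g (R + i) hxi, ih, ← pow_mul, ← pow_succ]

end OrbitProducts

/-! ### The absolute non-norm lemma at depth `w` -/

variable {κ : ZpExtension ℚ 2}

/-- Index bookkeeping for `toZModPow`: congruences `≡ ±1` at equal moduli. [folklore] -/
theorem toZModPow_eq_one_or_iff_of_eq {N N' : ℕ} (h : N = N') (x : ℤ_[2]) :
    (toZModPow N x = 1 ∨ toZModPow N x = -1) ↔ (toZModPow N' x = 1 ∨ toZModPow N' x = -1) := by
  subst h; exact Iff.rfl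

/-- **The tower non-norm lemma at depth `w`, absolute form.** For `v ∋ 2`, a ring isomorphism `e : ℚ_v ≃ ℚ₂`, `q ∈ ℚ_v`
with `e q = 2^k · u`, `u ∈ ℤ₂ˣ` of depth `w` (`‖u² − 1‖ = 2^{−(w+3)}`, i.e. `ord₂ log₂ q = w + 2`, BRICK S1), `a` odd and
`m = j + w + 1`: **no element of the local layer `F_m` has norm `q^{2^j a}`** — norms from `F_m` have unit part
`≡ ±1 (mod 2^{m+2})` (tower-1's `mem_range_norm_fixedField_layer_iff`), while `u^{2^j a} ≢ ±1 (mod 2^{j+w+3})` (BRICK S1).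
The case `w = 0` (`u ≡ ±3 (mod 8)`) is tower-1's `norm_ne_pow_of_tateUnit`.
[cite: NeukirchANT1999, Ch. V §1 Thm. (1.1)] [cite: GreenbergLNM1716, §3, between Prop. 3.6 and Prop. 3.7 (PDF pp. 92–93)] -/
theorem norm_ne_pow_of_depth (hκ : κ.IsCyclotomic) (v : HeightOneSpectrum (𝓞 ℚ))
    (hv : ((2 : ℕ) : 𝓞 ℚ) ∈ v.asIdeal) (p : ℕ) [Fact p.Prime] (hp : p = 2)
    (e : v.adicCompletion ℚ ≃+* ℚ_[p]) {q : v.adicCompletion ℚ} {k : ℕ} {u : ℤ_[p]ˣ}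
    (hq : e q = (p : ℚ_[p]) ^ k * ((u : ℤ_[p]) : ℚ_[p])) {w : ℕ}
    (hu : ‖(u : ℤ_[p]) ^ 2 - 1‖ = (2 : ℝ) ^ (-((w : ℤ) + 3))) {a : ℕ} (ha : Odd a) {j m : ℕ} (hm : m = j + w + 1)
    (f : IntermediateField.fixedField (localSubgroup (κ.layerSubgroup m) (v.adicCompletion ℚ))) :
    Algebra.norm (v.adicCompletion ℚ) f ≠ q ^ (2 ^ j * a) := by
  subst hp
  subst hm
  intro hf
  -- `q ≠ 0` and the norm is a unit of `ℚ_v`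
  have hq' : e q = (2 : ℚ_[2]) ^ k * ((u : ℤ_[2]) : ℚ_[2]) := by simpa using hq
  have hq0 : q ≠ 0 := by
    intro h0
    rw [h0, map_zero, eq_comm, mul_eq_zero] at hq'
    rcases hq' with h | h
    · exact absurd h (pow_ne_zero _ (by norm_num))
    · exact u.ne_zero (PadicInt.coe_eq_zero.mp h)
  haveI := finiteDimensional_fixedField_localSubgroup_layerSubgroup (κ := κ) v (j + w + 1)
  have hmem : Units.mk0 (q ^ (2 ^ j * a)) (pow_ne_zero _ hq0) ∈
      (Units.map (Algebra.norm (v.adicCompletion ℚ) :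
        IntermediateField.fixedField (localSubgroup (κ.layerSubgroup (j + w + 1)) (v.adicCompletion ℚ)) →*
          v.adicCompletion ℚ)).range := by
    have hf0 : f ≠ 0 := by
      rintro rfl
      rw [Algebra.norm_zero] at hf
      exact pow_ne_zero _ hq0 hf.symm
    exact ⟨Units.mk0 f hf0, Units.ext (by simp [hf])⟩
  rw [mem_range_norm_fixedField_layer_iff hκ v hv (by omega) 2 rfl e] at hmem
  obtain ⟨j', w', hw', hjw⟩ := hmem
  have hlhs : e (q ^ (2 ^ j * a)) = (2 : ℚ_[2]) ^ (((k * (2 ^ j * a) : ℕ)) : ℤ) *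
      (((u ^ (2 ^ j * a) : ℤ_[2]ˣ) : ℤ_[2]) : ℚ_[2]) := by
    rw [map_pow, hq', mul_pow, ← pow_mul, zpow_natCast, Units.val_pow_eq_pow_val, PadicInt.coe_pow]
  rw [Units.val_mk0, hlhs] at hjw
  have hjw' : (2 : ℚ_[2]) ^ (((k * (2 ^ j * a) : ℕ)) : ℤ) * (((u ^ (2 ^ j * a) : ℤ_[2]ˣ) : ℤ_[2]) : ℚ_[2]) =
      (2 : ℚ_[2]) ^ j' * ((w' : ℤ_[2]) : ℚ_[2]) := by simpa using hjw
  obtain ⟨-, hwU⟩ := two_zpow_mul_units_inj hjw'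
  -- `w' = u ^ (2^j a)` has residue `≢ ±1 (mod 2^{j+w+3})`
  have hu' : ‖(u : ℤ_[2]) ^ 2 - 1‖ = (2 : ℝ) ^ (-(((w + 2 : ℕ) : ℤ) + 1)) := by
    rw [hu]; congr 1
  obtain ⟨h1, h2⟩ := toZModPow_pow_ne_one_and_ne_neg_one_of_depth (s := w + 2) (by omega) hu' ha j
  rw [← Units.val_pow_eq_pow_val, hwU] at h1 h2
  have hw'' := (toZModPow_eq_one_or_iff_of_eq (show j + w + 1 + 2 = w + 2 + j + 1 by ring) (w' : ℤ_[2])).mp hw'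
  rcases hw'' with h | h
  · exact h1 h
  · exact h2 h

/-! ### The relative non-norm lemma in orbit-product form -/

/-- **`∏_{i<2^R} g^i(f) ≠ q^{2^j a}` for `f ∈ F_{n+R}`, `R = j + w + 1`, `a` odd, `q` of depth `w`.** Here `κ` is the
cyclotomic `ℤ₂`-extension, `v ∋ 2`, `g ∈ Γ_{ℚ_v}` with `κ(res g) = 2^n u_g` (a topological generator of `H_n` modulo `H_∞`),
`e : ℚ_v ≃ ℚ₂` a ring isomorphism and `q ∈ ℚ_v` with `e q = 2^k u`, `‖u² − 1‖ = 2^{−(w+3)}`. With `g₀`, `κ(res g₀) = 1`, the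
elements `g₀^i g^j` (`i < 2^n`, `j < 2^R`) represent `Γ/H_{n+R}`, so `N_{F_{n+R}/ℚ_v}(f) = ∏_i g₀^i(∏_j g^j f)`; if the inner
product were `q^{2^j a} ∈ ℚ_v` the norm would be `q^{2^{n+j} a}`, contradicting `norm_ne_pow_of_depth` at level
`n + R = (n + j) + w + 1`. This is `q^{2^j a} ∉ N(F_{n+R}/F_n)` — the order of `[q]` in `F_nˣ/N(F_{n+R}ˣ)` is at least
`2^{R−w}` — in the form consumed by the split count; `w = 0` is tower-1's `prod_smul_ne_pow_of_tateUnit`.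
[cite: NeukirchANT1999, Ch. V §1 Thm. (1.1)] [cite: GreenbergLNM1716, §3, between Prop. 3.6 and Prop. 3.7 (PDF pp. 92–93)] -/
theorem prod_smul_ne_pow_of_depth (hκ : κ.IsCyclotomic) (v : HeightOneSpectrum (𝓞 ℚ))
    (hv : ((2 : ℕ) : 𝓞 ℚ) ∈ v.asIdeal) (p : ℕ) [Fact p.Prime] (hp : p = 2)
    (e : v.adicCompletion ℚ ≃+* ℚ_[p]) {q : v.adicCompletion ℚ} {k : ℕ} {u : ℤ_[p]ˣ}
    (hq : e q = (p : ℚ_[p]) ^ k * ((u : ℤ_[p]) : ℚ_[p])) {w : ℕ}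
    (hu : ‖(u : ℤ_[p]) ^ 2 - 1‖ = (2 : ℝ) ^ (-((w : ℤ) + 3)))
    (n : ℕ) {g : absoluteGaloisGroup (v.adicCompletion ℚ)} {ug : ℤ_[2]ˣ}
    (hug : ((κ (resGal (K := ℚ) (v.adicCompletion ℚ) g)).toAdd : ℤ_[2]) = 2 ^ n * (ug : ℤ_[2]))
    {a : ℕ} (ha : Odd a) {j R : ℕ} (hR : R = j + w + 1) {f : AlgebraicClosure (v.adicCompletion ℚ)}
    (hf : ∀ h ∈ localSubgroup (κ.layerSubgroup (n + R)) (v.adicCompletion ℚ), h • f = f) :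
    (∏ i ∈ Finset.range (2 ^ R), (g ^ i) • f) ≠
      algebraMap (v.adicCompletion ℚ) (AlgebraicClosure (v.adicCompletion ℚ)) (q ^ (2 ^ j * a)) := by
  intro hprod
  -- a local element `g₀` with `κ(res g₀) = 1`, and the representatives `g₀^i g^j` of `Γ/H_{n+R}`
  obtain ⟨g₀, hg₀'⟩ := surjective_kappa_comp_resGal hκ v hv (Multiplicative.ofAdd (1 : ℤ_[2]))
  have hg₀ : ((κ (resGal (K := ℚ) (v.adicCompletion ℚ) g₀)).toAdd : ℤ_[2]) = 2 ^ 0 * ((1 : ℤ_[2]ˣ) : ℤ_[2]) := by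
    have h := congrArg Multiplicative.toAdd hg₀'
    rw [toAdd_ofAdd] at h
    rw [pow_zero, Units.val_one, one_mul]
    exact h
  have hcov : ∀ σ : absoluteGaloisGroup (v.adicCompletion ℚ), ∃ ji : Fin (2 ^ n) × Fin (2 ^ R),
      σ⁻¹ * (g₀ ^ (ji.1 : ℕ) * g ^ (ji.2 : ℕ)) ∈ localSubgroup (κ.layerSubgroup (n + R)) (v.adicCompletion ℚ) := by
    intro σ
    have hσ0 : σ ∈ localSubgroup (κ.layerSubgroup 0) (v.adicCompletion ℚ) := by
      rw [mem_localSubgroup_iff, ZpExtension.mem_layerSubgroup, pow_zero]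
      exact one_dvd _
    obtain ⟨i, hi, hiσ⟩ := exists_pow_inv_mul_mem_localSubgroup_layerSubgroup (κ := κ) v 0 n hg₀ hσ0
    rw [Nat.zero_add] at hiσ
    obtain ⟨i', hi', hi'σ⟩ := exists_pow_inv_mul_mem_localSubgroup_layerSubgroup (κ := κ) v n R hug hiσ
    refine ⟨(⟨i, hi⟩, ⟨i', hi'⟩), ?_⟩
    have h := Subgroup.inv_mem _ hi'σ
    have heq : ((g ^ i')⁻¹ * ((g₀ ^ i)⁻¹ * σ))⁻¹ = σ⁻¹ * (g₀ ^ i * g ^ i') := by group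
    rw [heq] at h
    exact h
  -- the fixed field `F_{n+R}` and `f` as its element
  haveI := finiteDimensional_fixedField_localSubgroup_layerSubgroup (κ := κ) v (n + R)
  haveI := isGalois_fixedField_localSubgroup_layerSubgroup (κ := κ) v (n + R)
  have hrank := finrank_fixedField_localSubgroup_layerSubgroup hκ v hv (n + R)
  have hopen := isOpen_localSubgroup (κ.layerSubgroup (n + R)) (κ.isOpen_layerSubgroup (n + R)) (v.adicCompletion ℚ)
  let f' : IntermediateField.fixedField (localSubgroup (κ.layerSubgroup (n + R)) (v.adicCompletion ℚ)) :=
    ⟨f, (IntermediateField.mem_fixedField_iff _ _).mpr fun h hh ↦ hf h hh⟩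
  have hne := norm_ne_pow_of_depth hκ v hv p hp e hq hu ha (j := n + j) (m := n + R) (by omega) f'
  have hcard : Fintype.card (Fin (2 ^ n) × Fin (2 ^ R)) = Module.finrank (v.adicCompletion ℚ)
      (IntermediateField.fixedField (localSubgroup (κ.layerSubgroup (n + R)) (v.adicCompletion ℚ))) := by
    rw [hrank, Fintype.card_prod, Fintype.card_fin, Fintype.card_fin, pow_add]
  -- (`CharZero ℚ_v` only now: it changes the preferred `Algebra ℚ ℚ_v` instance, see tower-1's BRICK 14)
  haveI : CharZero (v.adicCompletion ℚ) :=
    charZero_of_injective_algebraMap (algebraMap ℚ (v.adicCompletion ℚ)).injective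
  have hfix := fixingSubgroup_fixedField_of_isOpen _ hopen
  have hH := fun σ ↦ SetLike.ext_iff.mp hfix σ
  have hnorm := algebraMap_norm_eq_prod_smul v _ hH (fun ji : Fin (2 ^ n) × Fin (2 ^ R) ↦ g₀ ^ (ji.1 : ℕ) * g ^ (ji.2 : ℕ))
    hcov hcard f'
  -- `∏_{i,j} g₀^i g^j f = ∏_i g₀^i (q^N) = q^{N 2^n}`
  have hinner : ∀ i : Fin (2 ^ n), (∏ i' : Fin (2 ^ R), (g₀ ^ (i : ℕ) * g ^ (i' : ℕ)) •
      (f' : AlgebraicClosure (v.adicCompletion ℚ))) =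
        algebraMap (v.adicCompletion ℚ) (AlgebraicClosure (v.adicCompletion ℚ)) (q ^ (2 ^ j * a)) := by
    intro i
    have h1 : (∏ i' : Fin (2 ^ R), (g₀ ^ (i : ℕ) * g ^ (i' : ℕ)) • (f' : AlgebraicClosure (v.adicCompletion ℚ))) =
        g₀ ^ (i : ℕ) • ∏ i' ∈ Finset.range (2 ^ R), (g ^ i') • f := by
      rw [← Fin.prod_univ_eq_prod_range (fun i' ↦ (g ^ i') • f) (2 ^ R), Finset.smul_prod']
      refine Finset.prod_congr rfl fun i' _ ↦ ?_
      rw [mul_smul]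
    rw [h1, hprod]
    exact AlgEquiv.commutes (absoluteGaloisGroup.toAlgEquiv _ (g₀ ^ (i : ℕ))) _
  rw [Fintype.prod_prod_type, Finset.prod_congr rfl (fun i _ ↦ hinner i), Finset.prod_const, Finset.card_univ,
    Fintype.card_fin, ← map_pow, ← pow_mul] at hnorm
  have hNe : Algebra.norm (v.adicCompletion ℚ) f' = q ^ (2 ^ j * a * 2 ^ n) :=
    (algebraMap (v.adicCompletion ℚ) (AlgebraicClosure (v.adicCompletion ℚ))).injective hnorm
  have hexp : 2 ^ j * a * 2 ^ n = 2 ^ (n + j) * a := by rw [pow_add]; ring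
  rw [hexp] at hNe
  exact hne hNe

end Summit.BirchSwinnertonDyer.BirchSwinnertonDyer.Theorems.MultTowerSplitOrder

end
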